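import Summits.AtomisticToContinuum.HydrodynamicLimit.Theorems.StiffCollisionalRelaxationAprioriBoundsFibreLinStatL1Glue
import Summits.AtomisticToContinuum.HydrodynamicLimit.Theorems.StiffCollisionalRelaxationAprioriBoundsFibreHydroRateEquilibrium
import Summits.AtomisticToContinuum.HydrodynamicLimit.Theorems.StiffCollisionalRelaxationAprioriBoundsFibreEnergyMoment
import HarnessLib

/-!
# Equilibrium unit test of the stub `stub_linStatL1` (line `fibre-deficit-transfer`, skeleton r4; crux `AprioriBounds`,
stmt-AtomisticToContinuum-14827)

Support file (`--supports stmt-AtomisticToContinuum-14827`) of the stub-worker of `stub_linStatL1` (the OPEN rate-free dynamical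
input `LinStatL1VanishAt`: `∫₀ᵗ E_N|ℓ_s ∘ Φ_s| ds → 0`).  On the equilibrium rung — constant profiles `a₀ ≡ ac > 0`, `u₀ ≡ uc`,
`θ₀ ≡ θc > 0` and the constant classical solution `ρ ≡ 1`, `u ≡ uc`, `θ ≡ θc` — the statement is TRUE for every `0 < σ ≤ 1/2`,
every flow family `Φ` and every horizon `t ≥ 0` (`linStatL1_equilibrium`, registered sub-goal): the rated fixed-time statistic holds
there with `b = p = 1/4` (`hydroRate_equilibrium`: `ℓ_s` is a function of the conserved totals, Bienaymé–Chebyshev given the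
positions), the exponential energy moment holds for all nice profiles (`stub_energyMoment`), and the glue `linStatL1_of_hydroRate`
(`…FibreLinStatL1Glue`: convergence in probability + uniform integrability + dominated convergence in `s`) turns them into
hydrodynamics in the mean on `[0, t]` (the regularity hypotheses are trivial for constant fields).

No new definitions, no named facts; axioms `propext`, `Classical.choice`, `Quot.sound`.
-/

noncomputable section

open MeasureTheory Filter Set Topology
open scoped ENNReal

namespace Summit.AtomisticToContinuum.HydrodynamicLimit.Theorems.FibreDeficitTransfer

open Literature.MathematicalPhysics.KineticTheory Literature.Analysis.FluidPDE
open Summit.AtomisticToContinuum.HydrodynamicLimit.Theorems.AprioriBoundsNegative (PartOneAt PartTwoAt)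
open Summit.AtomisticToContinuum.HydrodynamicLimit.Theorems.VisitLedgerUpscattering (Cfg Flow Flows NiceProfiles)

/-- **EQUILIBRIUM INSTANCE OF `stub_linStatL1`** (registered sub-goal `linStatL1_equilibrium` of the crux).  At constant profiles
`(ac, uc, θc)` and the constant classical solution `(1, uc, θc)`, `LinStatL1VanishAt` holds for every `0 < σ ≤ 1/2`, every flow
family and every horizon `t ≥ 0`: `LinearHydroRateAt` on the rung (`hydroRate_equilibrium`) and `EnergyMomentAt`
(`stub_energyMoment`) through the glue `linStatL1_of_hydroRate`. -/
theorem linStatL1_equilibrium : ∀ (σ ac θc : ℝ) (uc : V3), 0 < σ → σ ≤ 1 / 2 → 0 < ac → 0 < θc → ∀ (Φ : (N : ℕ) → HardSphereFlow (Torus.geometry (Fin 3)) (hsDiameter σ N) (N + 1)) (t : ℝ), 0 ≤ t → LinStatL1VanishAt σ (fun _ => ac) (fun _ => θc) (fun _ => uc) (fun _ _ => 1) (fun _ _ => θc) (fun _ _ => uc) Φ t := by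
  intro σ ac θc uc hσ hσ2 hac hθc Φ t ht
  have hP : NiceProfiles (fun _ => ac) (fun _ => θc) (fun _ => uc) :=
    ⟨continuous_const, continuous_const, continuous_const, fun _ => hac, fun _ => hθc⟩
  exact linStatL1_of_hydroRate σ _ _ _ _ _ _ Φ t hσ2 hP ht continuousOn_const continuousOn_const continuousOn_const
    (fun _ _ _ => hθc) continuousOn_const (hydroRate_equilibrium σ ac θc uc hσ2 hac hθc Φ t)
    (stub_energyMoment σ _ _ _ Φ hσ hσ2 hP)

end Summit.AtomisticToContinuum.HydrodynamicLimit.Theorems.FibreDeficitTransfer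

end
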